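import Summits.CriticalPhenomena.PercolationContinuityZ3.Theorems.PercNearOneGluingAdditiveGluingBlockPeel
import Summits.CriticalPhenomena.PercolationContinuityZ3.Theorems.PercNearOneGluingAdditiveGluingFingerML3Reductions
import Literature.Probability.LatticeModels.ProdBernoulliCoupling
import HarnessLib

/-! # Crux `PercNearOneGluing.AdditiveGluing` (stmt-CriticalPhenomena-4576) — the finger multi-edge Lemma 3 (registered open stub
# `stub_fingerML3_vp`): PEELING a relay, and the classes it settles (seat (b) V⁺-form, depth prover `png-dp-vplus`)

Support file (`--supports stmt-CriticalPhenomena-4576`); no definitions, no named facts.  Companions: `…AdditiveGluingBlockPeel.lean`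
(`block_multiEdge_peel`, `glue_restricted_of_unglued`), `…AdditiveGluingFingerML3Reductions.lean` (`fingerML3_of_qMinimal`).

Setting of `stub_fingerML3_vp`: a weighting `K` on `Fin n`, relays `A ∋ b`, a finger block `N` (`Disjoint N A`, every positive-weight pair at
`N` goes to `A` or stays inside `N`), `g = K/N` the glued weighting, `R_A` = "some pair `N–A` is open", `q` = `K` with every pair at `N` killed
(the base), FML3(A, K) : `μ_g(R_A ∩ {d↔b}) ≤ μ_g(R_A ∩ ⋃_{v∈N}{v↔b})`.

* `fingerML3_peel` — **peeling the contacts at one relay `a ≠ d`**: if `μ_K(d↔b) ≤ μ_K(a↔b)` (the stub's UNGLUED hypothesis at the single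
  relay `a`) and FML3(A ∖ {a}, K ⊖ (N–a)) holds for the weighting with the pairs `N–a` killed, then FML3(A, K).  The hypothesis at `a` is
  spent through Kozma–Nitzan Lemma 3(ii) + the restricted Lemma 3(i) on `{d ↮ N}` (`block_multiEdge_peel`).
* `fingerML3_of_baseMin_erase` — FML3(A, K) whenever `d` is `q`-minimal over `A` except possibly at ONE relay `a₀` and `μ_K(d↔b) ≤ μ_K(a₀↔b)`:
  peel `a₀`, then `d` is the Question-9 designation of the block for the remaining relays (`fingerML3_of_qMinimal`; killing `N–a₀` does not
  change `q`).  In the stub's language: the glue-drift obstruction needs at least TWO relays that are `q`-below the designation.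
* `fingerML3_of_eq_target` — the degenerate case `d = b`.
* `fingerML3_of_card_le_three` — **`stub_fingerML3_vp` for `|A| ≤ 3`** (relays `b`, `d` and at most one more), no further hypothesis.
Depth-prover numerics (exact enumeration, n ≤ 8, ≈ 60 hard instances with glue drift): one peel + `q`-minimality settles all but the instances
with two `q`-weak contact relays; iterated peeling needs the comparison in the peeled weighting (designation drift; 27/28 by search).
[cite: KozmaNitzan2024, Lemma 3(i)–(ii) (pp. 6–7), Lemma 5 (p. 13), §3.2 pp. 12–14, Question 9 (p. 36)]
-/

namespace Summit.CriticalPhenomena.PercolationContinuityZ3.Theorems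

open MeasureTheory Set
open Literature.Probability.LatticeModels (prodBernoulli)
open Literature.Probability.Percolation (BondConfig openConn openGraph openEdgeCluster pinW localCylinder
  DeterminedBy determinedBy_iff)

noncomputable section
open Classical

section FingerPeel

open Literature.Probability.LatticeModels Literature.Probability.Percolation

variable {n : ℕ}

/-- The stub's contact event over `A` is the contact event of the pair set `F₁ ∪ F_a`, `F₁` = pairs `N–(A∖a)`, `F_a` = pairs `N–a`
(`a ∈ A`). [folklore] -/
theorem fingerContact_R_eq_union (N A : Finset (Fin n)) {a : Fin n} (ha : a ∈ A) :
    ({ω : Set (Sym2 (Fin n)) | ∃ v ∈ N, ∃ a' ∈ A, s(v, a') ∈ ω} : Set (BondConfig (Fin n))) =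
      {ω | ∃ e ∈ ((N ×ˢ A.erase a).image (fun va : Fin n × Fin n => s(va.1, va.2))) ∪ N.image (fun v => s(v, a)), e ∈ ω} := by
  ext ω
  simp only [Set.mem_setOf_eq, Finset.mem_union, Finset.mem_image, Finset.mem_product, Finset.mem_erase]
  constructor
  · rintro ⟨v, hv, a', ha', h⟩
    by_cases haa : a' = a
    · subst haa
      exact ⟨s(v, a'), Or.inr ⟨v, hv, rfl⟩, h⟩
    · exact ⟨s(v, a'), Or.inl ⟨(v, a'), ⟨hv, haa, ha'⟩, rfl⟩, h⟩
  · rintro ⟨e, he, heω⟩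
    rcases he with ⟨⟨v, a'⟩, ⟨hv, -, ha'⟩, rfl⟩ | ⟨v, hv, rfl⟩
    · exact ⟨v, hv, a', ha', heω⟩
    · exact ⟨v, hv, a, ha, heω⟩

/-- Killing the pairs `N–a` in the glued weighting is gluing the weighting with the pairs `N–a` killed (`a ∉ N`). [folklore] -/
theorem fingerPeel_pinW_glue_eq (K : Sym2 (Fin n) → unitInterval) (N : Finset (Fin n)) {a : Fin n} (haN : a ∉ N) :
    pinW (fun e' : Sym2 (Fin n) => if (∀ y ∈ e', y ∈ N) ∧ ¬ e'.IsDiag then 1 else K e')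
        (↑(N.image (fun v => s(v, a))) : Set (Sym2 (Fin n))) (∅ : Set (Sym2 (Fin n))) =
      fun e' : Sym2 (Fin n) => if (∀ y ∈ e', y ∈ N) ∧ ¬ e'.IsDiag then 1 else
        if (∃ v ∈ N, e' = s(v, a)) then (0 : unitInterval) else K e' := by
  funext e
  by_cases he : e ∈ (↑(N.image (fun v => s(v, a))) : Set (Sym2 (Fin n)))
  · rw [pinW_apply_of_mem_of_not_mem _ he (Set.notMem_empty e)]
    obtain ⟨v, hv, rfl⟩ := Finset.mem_image.1 (Finset.mem_coe.1 he)
    have h1 : ¬ ((∀ y ∈ s(v, a), y ∈ N) ∧ ¬ (s(v, a)).IsDiag) := fun h => haN (h.1 a (Sym2.mem_mk_right v a))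
    have h2 : ∃ v' ∈ N, s(v, a) = s(v', a) := ⟨v, hv, rfl⟩
    simp only [h1, h2, if_false, if_true]
  · rw [pinW_apply_of_not_mem _ _ he]
    have h2 : ¬ (∃ v' ∈ N, e = s(v', a)) := by
      rintro ⟨v', hv', rfl⟩
      exact he (Finset.mem_coe.2 (Finset.mem_image.2 ⟨v', hv', rfl⟩))
    simp only [h2, if_false]

/-- **Peeling the contacts at one relay.**  Finger/stub setting with `d, a ∈ A`, `a ≠ d`.  If `μ_K(d ↔ b) ≤ μ_K(a ↔ b)` (unglued) and
FML3 holds for the relay set `A ∖ {a}` in the weighting `K ⊖ (N–a)` (pairs `s(v,a)`, `v ∈ N`, killed), then FML3 holds for `A` in `K`: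
`μ_{K/N}(R_A ∩ {d↔b}) ≤ μ_{K/N}(R_A ∩ ⋃_{v∈N}{v↔b})`.  (`glue_restricted_of_unglued` + `block_multiEdge_peel`.)
[cite: KozmaNitzan2024, Lemma 3(i)–(ii) (pp. 6–7), §3.2 pp. 12–14] -/
theorem fingerML3_peel (K : Sym2 (Fin n) → unitInterval) (A N : Finset (Fin n)) (d a b : Fin n)
    (hNA : Disjoint N A) (hd : d ∈ A) (ha : a ∈ A) (hda : d ≠ a)
    (hle : (prodBernoulli K).real (openConn d b) ≤ (prodBernoulli K).real (openConn a b))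
    (hsub : (prodBernoulli (fun e' : Sym2 (Fin n) => if (∀ y ∈ e', y ∈ N) ∧ ¬ e'.IsDiag then 1 else
              if (∃ v ∈ N, e' = s(v, a)) then (0 : unitInterval) else K e')).real
          ({ω : Set (Sym2 (Fin n)) | ∃ v ∈ N, ∃ a' ∈ A.erase a, s(v, a') ∈ ω} ∩ openConn d b) ≤
        (prodBernoulli (fun e' : Sym2 (Fin n) => if (∀ y ∈ e', y ∈ N) ∧ ¬ e'.IsDiag then 1 else
              if (∃ v ∈ N, e' = s(v, a)) then (0 : unitInterval) else K e')).real
          ({ω : Set (Sym2 (Fin n)) | ∃ v ∈ N, ∃ a' ∈ A.erase a, s(v, a') ∈ ω} ∩ ⋃ v ∈ N, openConn v b)) :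
    (prodBernoulli (fun e' : Sym2 (Fin n) => if (∀ y ∈ e', y ∈ N) ∧ ¬ e'.IsDiag then 1 else K e')).real
        ({ω : Set (Sym2 (Fin n)) | ∃ v ∈ N, ∃ a' ∈ A, s(v, a') ∈ ω} ∩ openConn d b) ≤
      (prodBernoulli (fun e' : Sym2 (Fin n) => if (∀ y ∈ e', y ∈ N) ∧ ¬ e'.IsDiag then 1 else K e')).real
        ({ω : Set (Sym2 (Fin n)) | ∃ v ∈ N, ∃ a' ∈ A, s(v, a') ∈ ω} ∩ ⋃ v ∈ N, openConn v b) := by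
  set g : Sym2 (Fin n) → unitInterval := fun e' => if (∀ y ∈ e', y ∈ N) ∧ ¬ e'.IsDiag then 1 else K e' with hg
  set Fa : Finset (Sym2 (Fin n)) := N.image (fun v => s(v, a)) with hFadef
  set F₁ : Finset (Sym2 (Fin n)) := (N ×ˢ A.erase a).image (fun va : Fin n × Fin n => s(va.1, va.2)) with hF₁def
  have haN : a ∉ N := Finset.disjoint_left.1 hNA.symm ha
  have hdN : d ∉ N := Finset.disjoint_left.1 hNA.symm hd
  have hFa : ∀ e ∈ Fa, ∃ v ∈ N, e = s(v, a) := by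
    intro e he
    obtain ⟨v, hv, rfl⟩ := Finset.mem_image.1 he
    exact ⟨v, hv, rfl⟩
  have hrestr := glue_restricted_of_unglued K N d a b hle
  have hpin := fingerPeel_pinW_glue_eq K N haN
  have hii : (prodBernoulli (pinW g (↑Fa : Set (Sym2 (Fin n))) (∅ : Set (Sym2 (Fin n))))).real
        ({ω : Set (Sym2 (Fin n)) | ∃ e ∈ F₁, e ∈ ω} ∩ openConn d b) ≤
      (prodBernoulli (pinW g (↑Fa : Set (Sym2 (Fin n))) (∅ : Set (Sym2 (Fin n))))).real
        ({ω : Set (Sym2 (Fin n)) | ∃ e ∈ F₁, e ∈ ω} ∩ ⋃ s ∈ N, openConn s b) := by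
    rw [hpin, ← fingerContact_R_eq N (A.erase a)]
    exact hsub
  rw [fingerContact_R_eq_union N A ha]
  exact block_multiEdge_peel g N F₁ Fa a d b hFa haN hdN hda hrestr hii

/-- `{b ↔ b}` is sure. [folklore] -/
theorem openConn_self_real_eq_one (p : Sym2 (Fin n) → unitInterval) (b : Fin n) :
    (prodBernoulli p).real (openConn b b) = 1 := by
  have : (openConn b b : Set (BondConfig (Fin n))) = Set.univ :=
    Set.eq_univ_of_forall fun ω => SimpleGraph.Reachable.refl _
  rw [this, probReal_univ]

/-- **FML3 in the degenerate case `d = b`.**  If `μ_K(b↔b) ≤ μ_K(a↔b)` for every `a ∈ A` then every relay is almost surely joined to `b`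
(also after gluing), so on the contact event the block reaches `b` almost surely. [folklore] -/
theorem fingerML3_of_eq_target (K : Sym2 (Fin n) → unitInterval) (A N : Finset (Fin n)) (b : Fin n)
    (hNA : Disjoint N A)
    (hle : ∀ a ∈ A, (prodBernoulli K).real (openConn b b) ≤ (prodBernoulli K).real (openConn a b)) :
    (prodBernoulli (fun e' : Sym2 (Fin n) => if (∀ y ∈ e', y ∈ N) ∧ ¬ e'.IsDiag then 1 else K e')).real
        ({ω : Set (Sym2 (Fin n)) | ∃ v ∈ N, ∃ a' ∈ A, s(v, a') ∈ ω} ∩ openConn b b) ≤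
      (prodBernoulli (fun e' : Sym2 (Fin n) => if (∀ y ∈ e', y ∈ N) ∧ ¬ e'.IsDiag then 1 else K e')).real
        ({ω : Set (Sym2 (Fin n)) | ∃ v ∈ N, ∃ a' ∈ A, s(v, a') ∈ ω} ∩ ⋃ v ∈ N, openConn v b) := by
  set g : Sym2 (Fin n) → unitInterval := fun e' => if (∀ y ∈ e', y ∈ N) ∧ ¬ e'.IsDiag then 1 else K e' with hg
  set R : Set (BondConfig (Fin n)) := {ω : Set (Sym2 (Fin n)) | ∃ v ∈ N, ∃ a' ∈ A, s(v, a') ∈ ω} with hR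
  set U : Set (BondConfig (Fin n)) := ⋃ v ∈ N, openConn v b with hU
  have hmeas : ∀ s : Set (BondConfig (Fin n)), MeasurableSet s := fun _ => MeasurableSet.of_discrete
  have hKg : K ≤ g := by
    intro e
    by_cases h : (∀ y ∈ e, y ∈ N) ∧ ¬ e.IsDiag
    · show K e ≤ (if (∀ y ∈ e, y ∈ N) ∧ ¬ e.IsDiag then (1 : unitInterval) else K e)
      rw [if_pos h]; exact unitInterval.le_one'
    · show K e ≤ (if (∀ y ∈ e, y ∈ N) ∧ ¬ e.IsDiag then (1 : unitInterval) else K e)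
      rw [if_neg h]
  -- every relay is a.s. joined to `b` in `g`
  have hnull : ∀ a ∈ A, (prodBernoulli g).real (openConn a b)ᶜ = 0 := by
    intro a haA
    have h1 : 1 ≤ (prodBernoulli g).real (openConn a b) := by
      calc (1 : ℝ) = (prodBernoulli K).real (openConn b b) := (openConn_self_real_eq_one K b).symm
        _ ≤ (prodBernoulli K).real (openConn a b) := hle a haA
        _ ≤ (prodBernoulli g).real (openConn a b) :=
            prodBernoulli_real_mono_of_isUpperSet hKg (isUpperSet_openConn a b) (hmeas _)
    have h2 : (prodBernoulli g).real (openConn a b) ≤ 1 := measureReal_le_one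
    rw [measureReal_compl (hmeas _), probReal_univ]
    linarith
  -- `R \ U` is null: an open contact pair `s(v,a')` with `v ↮ b` forces `a' ↮ b`
  have hdiff : (prodBernoulli g).real (R \ U) = 0 := by
    refine le_antisymm ?_ measureReal_nonneg
    calc (prodBernoulli g).real (R \ U)
        ≤ (prodBernoulli g).real (⋃ a' ∈ A, (openConn a' b)ᶜ) := by
          refine measureReal_mono ?_ (measure_ne_top _ _)
          rintro ω ⟨⟨v, hv, a', ha', hva⟩, hωU⟩
          refine Set.mem_iUnion₂.2 ⟨a', ha', fun hab => hωU ?_⟩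
          have hva' : v ≠ a' := fun h => (Finset.disjoint_left.1 hNA hv) (h ▸ ha')
          have hadj : (openGraph ω).Adj v a' := (openGraph_adj ω v a').2 ⟨hva, hva'⟩
          exact Set.mem_iUnion₂.2 ⟨v, hv, hadj.reachable.trans hab⟩
      _ ≤ ∑ a' ∈ A, (prodBernoulli g).real (openConn a' b)ᶜ := measureReal_biUnion_finset_le A _
      _ = 0 := Finset.sum_eq_zero fun a' ha' => hnull a' ha'
  have hsplit := measureReal_inter_add_sdiff (μ := prodBernoulli g) (s := R) (hmeas U)
  calc (prodBernoulli g).real (R ∩ openConn b b)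
      ≤ (prodBernoulli g).real R := measureReal_mono Set.inter_subset_left
    _ = (prodBernoulli g).real (R ∩ U) := by rw [← hsplit, hdiff, add_zero]

/-- **FML3 when the designation is base-minimal except at one relay.**  Stub setting (`b, d ∈ A`, finger block `N`, `μ_K(d↔b) ≤ μ_K(a↔b)`
for all `a ∈ A`); `q` = `K` with every pair at `N` killed.  If `μ_q(d↔b) ≤ μ_q(a↔b)` for every `a ∈ A` other than `a₀`, then
`μ_{K/N}(R ∩ {d↔b}) ≤ μ_{K/N}(R ∩ ⋃_{v∈N}{v↔b})`.  Proof: if `a₀ ∉ A ∖ {b, d}` the designation is `q`-minimal (`fingerML3_of_qMinimal`);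
otherwise peel `a₀` (`fingerML3_peel`, hypothesis at `a₀`) and apply `fingerML3_of_qMinimal` to the relay set `A ∖ {a₀}` in `K ⊖ (N–a₀)`,
whose base is again `q`. [cite: KozmaNitzan2024, Lemma 3(i)–(ii) (pp. 6–7), Lemma 5 (p. 13), Question 9 (p. 36)] -/
theorem fingerML3_of_baseMin_erase (K : Sym2 (Fin n) → unitInterval) (A N : Finset (Fin n)) (d a₀ b : Fin n)
    (hNA : Disjoint N A) (hd : d ∈ A)
    (hfree : ∀ v ∈ N, ∀ y : Fin n, y ∉ A → y ∉ N → (K s(v, y) : ℝ) = 0)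
    (hle : ∀ a ∈ A, (prodBernoulli K).real (openConn d b) ≤ (prodBernoulli K).real (openConn a b))
    (hbase : ∀ a ∈ A, a ≠ a₀ →
      (prodBernoulli (fun e' : Sym2 (Fin n) => if (∃ y ∈ e', y ∈ N) then (0 : unitInterval) else K e')).real (openConn d b) ≤
        (prodBernoulli (fun e' : Sym2 (Fin n) => if (∃ y ∈ e', y ∈ N) then (0 : unitInterval) else K e')).real (openConn a b)) :
    (prodBernoulli (fun e' : Sym2 (Fin n) => if (∀ y ∈ e', y ∈ N) ∧ ¬ e'.IsDiag then 1 else K e')).real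
        ({ω : Set (Sym2 (Fin n)) | ∃ v ∈ N, ∃ a' ∈ A, s(v, a') ∈ ω} ∩ openConn d b) ≤
      (prodBernoulli (fun e' : Sym2 (Fin n) => if (∀ y ∈ e', y ∈ N) ∧ ¬ e'.IsDiag then 1 else K e')).real
        ({ω : Set (Sym2 (Fin n)) | ∃ v ∈ N, ∃ a' ∈ A, s(v, a') ∈ ω} ∩ ⋃ v ∈ N, openConn v b) := by
  set q : Sym2 (Fin n) → unitInterval := fun e' => if (∃ y ∈ e', y ∈ N) then (0 : unitInterval) else K e' with hq
  by_cases h0 : a₀ ∈ A ∧ a₀ ≠ d ∧ a₀ ≠ b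
  · obtain ⟨ha₀, ha₀d, ha₀b⟩ := h0
    refine fingerML3_peel K A N d a₀ b hNA hd ha₀ (Ne.symm ha₀d) (hle a₀ ha₀) ?_
    -- the peeled sub-problem: `d` is the Question-9 designation of the block for the relays `A \ {a₀}`
    set K' : Sym2 (Fin n) → unitInterval :=
      fun e' => if (∃ v ∈ N, e' = s(v, a₀)) then (0 : unitInterval) else K e' with hK'
    have hNA' : Disjoint N (A.erase a₀) := hNA.mono_right (Finset.erase_subset a₀ A)
    have hd' : d ∈ A.erase a₀ := Finset.mem_erase.2 ⟨Ne.symm ha₀d, hd⟩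
    have ha₀N : a₀ ∉ N := Finset.disjoint_left.1 hNA.symm ha₀
    have hfree' : ∀ v ∈ N, ∀ y : Fin n, y ∉ A.erase a₀ → y ∉ N → (K' s(v, y) : ℝ) = 0 := by
      intro v hv y hy hyN
      by_cases hya : ∃ v' ∈ N, s(v, y) = s(v', a₀)
      · simp only [hK', hya, if_true]
        rfl
      · simp only [hK', hya, if_false]
        have hyA : y ∉ A := by
          intro hyA
          have hya₀ : y = a₀ := by
            by_contra hne
            exact hy (Finset.mem_erase.2 ⟨hne, hyA⟩)
          exact hya ⟨v, hv, by rw [hya₀]⟩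
        exact hfree v hv y hyA hyN
    have hqq : (fun e' : Sym2 (Fin n) => if (∃ y ∈ e', y ∈ N) then (0 : unitInterval) else K' e') = q := by
      funext e'
      by_cases hN : ∃ y ∈ e', y ∈ N
      · simp only [hq, hN, if_true]
      · have hno : ¬ (∃ v ∈ N, e' = s(v, a₀)) := by
          rintro ⟨v, hv, rfl⟩
          exact hN ⟨v, Sym2.mem_mk_left v a₀, hv⟩
        simp only [hq, hK', hN, hno, if_false]
    have hdA' : ∀ a ∈ A.erase a₀,
        (prodBernoulli (fun e' : Sym2 (Fin n) => if (∃ y ∈ e', y ∈ N) then (0 : unitInterval) else K' e')).real (openConn d b) ≤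
          (prodBernoulli (fun e' : Sym2 (Fin n) => if (∃ y ∈ e', y ∈ N) then (0 : unitInterval) else K' e')).real
            (openConn a b) := by
      intro a haA
      rw [hqq]
      exact hbase a (Finset.mem_of_mem_erase haA) (Finset.ne_of_mem_erase haA)
    exact fingerML3_of_qMinimal K' (A.erase a₀) N d b hNA' hd' hfree' hdA'
  · -- `a₀` is not a third relay: `d` is `q`-minimal over all of `A`
    have hdA : ∀ a ∈ A, (prodBernoulli q).real (openConn d b) ≤ (prodBernoulli q).real (openConn a b) := by
      intro a haA
      by_cases haa : a = a₀
      · subst haa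
        by_cases had : a = d
        · rw [had]
        · have hab : a = b := by
            by_contra hab
            exact h0 ⟨haA, had, hab⟩
          rw [hab, openConn_self_real_eq_one q b]
          exact measureReal_le_one
      · exact hbase a haA haa
    exact fingerML3_of_qMinimal K A N d b hNA hd hfree hdA

/-- **`stub_fingerML3_vp` for at most three relays.**  Stub setting with `A.card ≤ 3` (so `A ⊆ {b, d, a₀}`): the finger multi-edge Lemma 3
holds — `μ_{K/N}(R ∩ {d↔b}) ≤ μ_{K/N}(R ∩ ⋃_{v∈N}{v↔b})` — with no further hypothesis (`fingerML3_of_baseMin_erase`: `d` is trivially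
`q`-below `b` and `d`; the case `d = b` is `fingerML3_of_eq_target`).
[cite: KozmaNitzan2024, Lemma 3(i)–(ii) (pp. 6–7), Lemma 5 (p. 13), §3.2 pp. 12–14] -/
theorem fingerML3_of_card_le_three (K : Sym2 (Fin n) → unitInterval) (A N : Finset (Fin n)) (d b : Fin n)
    (hb : b ∈ A) (hNA : Disjoint N A) (hd : d ∈ A) (hA : A.card ≤ 3)
    (hfree : ∀ v ∈ N, ∀ y : Fin n, y ∉ A → y ∉ N → (K s(v, y) : ℝ) = 0)
    (hle : ∀ a ∈ A, (prodBernoulli K).real (openConn d b) ≤ (prodBernoulli K).real (openConn a b)) :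
    (prodBernoulli (fun e' : Sym2 (Fin n) => if (∀ y ∈ e', y ∈ N) ∧ ¬ e'.IsDiag then 1 else K e')).real
        ({ω : Set (Sym2 (Fin n)) | ∃ v ∈ N, ∃ a' ∈ A, s(v, a') ∈ ω} ∩ openConn d b) ≤
      (prodBernoulli (fun e' : Sym2 (Fin n) => if (∀ y ∈ e', y ∈ N) ∧ ¬ e'.IsDiag then 1 else K e')).real
        ({ω : Set (Sym2 (Fin n)) | ∃ v ∈ N, ∃ a' ∈ A, s(v, a') ∈ ω} ∩ ⋃ v ∈ N, openConn v b) := by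
  by_cases hdb : d = b
  · subst hdb
    exact fingerML3_of_eq_target K A N d hNA hle
  -- the relays other than `b` and `d` form a set of cardinality ≤ 1
  set S : Finset (Fin n) := (A.erase b).erase d with hS
  have hdS : d ∈ A.erase b := Finset.mem_erase.2 ⟨hdb, hd⟩
  have hScard : S.card ≤ 1 := by
    have h1 : (A.erase b).card = A.card - 1 := Finset.card_erase_of_mem hb
    have h2 : S.card = (A.erase b).card - 1 := Finset.card_erase_of_mem hdS
    omega
  -- choose the exceptional relay
  have hex : ∃ a₀ : Fin n, ∀ a ∈ A, a ≠ a₀ → a = b ∨ a = d := by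
    by_cases hSne : S.Nonempty
    · obtain ⟨a₀, ha₀⟩ := hSne
      refine ⟨a₀, fun a haA hne => ?_⟩
      by_contra hcon
      push Not at hcon
      have haS : a ∈ S := Finset.mem_erase.2 ⟨hcon.2, Finset.mem_erase.2 ⟨hcon.1, haA⟩⟩
      exact hne (Finset.card_le_one.1 hScard a haS a₀ ha₀)
    · refine ⟨b, fun a haA hne => ?_⟩
      by_contra hcon
      push Not at hcon
      exact hSne ⟨a, Finset.mem_erase.2 ⟨hcon.2, Finset.mem_erase.2 ⟨hcon.1, haA⟩⟩⟩
  obtain ⟨a₀, ha₀⟩ := hex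
  refine fingerML3_of_baseMin_erase K A N d a₀ b hNA hd hfree hle fun a haA hne => ?_
  rcases ha₀ a haA hne with rfl | rfl
  · rw [openConn_self_real_eq_one _ a]
    exact measureReal_le_one
  · exact le_rfl

end FingerPeel

end

end Summit.CriticalPhenomena.PercolationContinuityZ3.Theorems
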